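import Summits.BirchSwinnertonDyer.BirchSwinnertonDyer.Theses.SmallImageMuTransfer
import Summits.BirchSwinnertonDyer.BirchSwinnertonDyer.Theorems.SmallImageMuTransferSchneiderX9RankOneOfOrderOne
import Literature.NumberTheory.EllipticCurves.CanonicalPAdicHeightHolds
import Literature.NumberTheory.EllipticCurves.CanonicalPAdicHeightAdmissibleProofs
import Literature.NumberTheory.EllipticCurves.MordellWeilTheoremProofs
import Literature.Barriers.BirchSwinnertonDyer.PAdicHeightNondegeneracyProofs
import HarnessLib

/-!
# Route `SmallImageMuTransfer` (rung K6), crux `SchneiderX9RankOne` (stmt-BirchSwinnertonDyer-19631):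
# the HEIGHT-ATOMIC face of the crux — `log_p(den x) ≠ 2 log_p σ_p(-x/y)` on admissible points

Helper file (`--supports stmt-BirchSwinnertonDyer-19631 --as helper`; nothing here closes an item and no
summit statement is proved; line lead bsd-line-k6-p3, gen 2).  The crux reads: for every X9 pair
`(W, p)` of analytic rank `1` and every CANONICAL `p`-adic height datum `Dh`, `Reg_p(E, Dh) ≠ 0`
(`SchneiderConjecture Dh`).  Its registered line `birth` phrases the open content ANALYTICALLY
(`stub_orderOne`: `[T¹] L_p(f, α, T) ≠ 0`), at the price of three published inputs (Perrin-Riou 1987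
Cor. 1.8, Gross–Zagier–Kolyvagin, modularity; helpers p415447, p606472).  This file records the cheapest
and most primitive phrasing the tree's vocabulary allows, kernel-checked:

* **per pair, no published input** (`schneiderConjecture_of_isAdmissible_of_ne_zero`,
  `canonicalPAdicHeight_ne_zero_of_schneiderConjecture`, `schneiderConjecture_iff_forall_isAdmissible`,
  `forall_isCanonical_schneiderConjecture_iff`): on a curve of Mordell–Weil rank `1`, for THE canonical
  datum, `Reg_p ≠ 0` iff SOME (iff EVERY) admissible rational point `Q = (x, y)` has
  `ĥ_p(Q) = log_p(den x) - 2 log_p σ_p(-x/y) ≠ 0`.  Ingredients, all THEOREMS of the tree: the rank-one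
  algebra of `Literature.Barriers.BirchSwinnertonDyer.PAdicHeightNondegeneracyProofs`
  (`not_schneiderConjecture_iff_of_rank_one`, `pairing_eq_zero_of_rank_one`), Mordell–Weil
  (`exists_isMordellWeilBasis_holds`), admissible multiples (`exists_admissible_nsmul_holds`), existence
  of the canonical datum at `p ≥ 5` good ordinary (`exists_isCanonical_holds`, via Blakestad–Grant's
  sigma function) — so NO height datum, NO `L`-function and NO Iwasawa theory is left in the statement
  (the rank-one equivalence is the one of crux 0487's support file
  `PAdicOrderV2PAdicOrderThesisR2StubRankOneSchneiderTightness`, `schneiderClause_iff_…`, re-derived off that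
  route's import cone);
* **class level, modulo Gross–Zagier–Kolyvagin ONLY** (`hGZK :
  rank_eq_analyticRank_of_analyticRank_le_one`, needed to read `analyticRank = 1` as `rank E(ℚ) = 1`):
  `schneiderX9RankOne_iff_heightForm`, and LITERALLY in coordinates
  `schneiderX9RankOne_iff_padicLog_den_ne`:

    `SchneiderX9RankOne ↔ ∀ rank-1 X9 pairs (W, p), ∀ admissible (x, y) ∈ E(ℚ),`
    `  log_p (den x) ≠ 2 · log_p σ_p(-x/y)`

  (`log_p` the Iwasawa logarithm `padicLog`, `σ_p` the canonical `p`-adic sigma function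
  `padicSigmaEval`).  This is the `p`-adic transcendence statement the wall consists of (for CM curves it
  is Bertrand's theorem, `BertrandCMHeightNonvanishing*.lean`; X9 excludes CM by definition); a SINGLE
  admissible rational point of a SINGLE rank-one X9 pair with equality refutes the crux, and a per-pair
  certificate of the inequality for ONE admissible point proves the crux AT THAT PAIR
  (`schneiderConjecture_of_isAdmissible_of_ne_zero`, no published input at all);
* the X9 height form is the registered OPEN CORE stub H `stub_schneiderRankOne` of crux 0515's line
  `height_side_schneider`, restricted to X9: `schneiderX9RankOne_of_stubH` (stub H ⟹ this crux, modulo GZK);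
* bookkeeping for line `birth`: the height form implies the open stub `stub_orderOne` modulo Perrin-Riou
  Cor. 1.8 + GZK (`orderOne_of_exists_heightForm`), and p606472's tightness holds without its existence
  hypothesis `hcan` (`orderOne_of_schneiderX9RankOne_uncond`, `schneiderX9RankOne_iff_orderOne_uncond`;
  `exists_isCanonical_holds` is a tree theorem).

Sources: Mazur–Stein–Tate 2006 §1 and Conj. 1.1 ("the `p`-adic height is nondegenerate"; `h_p(P) =
p⁻¹ log_p(σ(P)/d(P))`); Stein–Wuthrich 2013 §4.1 eq. (4.1); Mazur–Tate–Teitelbaum 1986 §II.4;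
Schneider 1982 §1.  HONEST FRAMING: the crux (rank-one Schneider for non-CM `E/ℚ` at good ordinary
`p ∈ {5, 7}`) stays OPEN; nothing below asserts anything about any curve beyond what the kernel proves.
-/

-- the summit and its single problem are both named `BirchSwinnertonDyer` (registry layout D-0017)
set_option linter.dupNamespace false

set_option autoImplicit false

noncomputable section

open scoped Classical MatrixGroups ModularForm

open CongruenceSubgroup WeierstrassCurve
open Literature.NumberTheory.EllipticCurves Literature.NumberTheory.EllipticCurves.ModularForms
  Literature.NumberTheory.EllipticCurves.Wuthrich2014

namespace Summit.BirchSwinnertonDyer.BirchSwinnertonDyer.Rank1Residual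

/-! ### Per pair: Schneider in rank one from / to one admissible point (no published input) -/

section PerPair

variable {W : WeierstrassCurve ℚ} [W.IsElliptic] {p : ℕ} [Fact p.Prime]

/-- **Per-pair certificate shape, no published input.** On a curve with `rank E(ℚ) = 1`, if THE
canonical datum `Dh` is given (`Dh.IsCanonical`: `⟨Q, Q⟩ = ĥ_p(Q)` on admissible points) and SOME
admissible rational point `Q` has `ĥ_p(Q) ≠ 0`, then `Reg_p(E, Dh) ≠ 0` (`SchneiderConjecture Dh`).
Proof: were `Reg_p = 0`, some point of infinite order would be isotropic
(`PAdicHeightData.not_schneiderConjecture_iff_of_rank_one`, Mordell–Weil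
`exists_isMordellWeilBasis_holds`), whence the pairing vanishes identically in rank one
(`PAdicHeightData.pairing_eq_zero_of_rank_one`), contradicting `⟨Q, Q⟩ = ĥ_p(Q) ≠ 0`.
[cite: MazurSteinTate2006, §1 and Conj. 1.1] [cite: MazurTateTeitelbaum1986Invent, §II.4] -/
theorem schneiderConjecture_of_isAdmissible_of_ne_zero (hr : W.mordellWeilRank = 1)
    {Dh : PAdicHeightData W p} (hDh : Dh.IsCanonical) {Q : W.toAffine.Point}
    (hQ : W.IsAdmissible p Q) (hne : W.canonicalPAdicHeight p Q ≠ 0) : SchneiderConjecture Dh := by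
  by_contra hS
  obtain ⟨P, hP, hPP⟩ :=
    (Dh.not_schneiderConjecture_iff_of_rank_one hr W.exists_isMordellWeilBasis_holds).mp hS
  exact hne ((hDh Q hQ).symm.trans (Dh.pairing_eq_zero_of_rank_one hr hP hPP Q Q))

/-- **Conversely**, on a curve with `rank E(ℚ) = 1`, `Reg_p(E, Dh) ≠ 0` for the canonical datum forces
`ĥ_p(Q) ≠ 0` for EVERY admissible rational point `Q` (admissible points have infinite order, and an
isotropic point of infinite order kills `Reg_p` in rank one,
`PAdicHeightData.not_schneiderConjecture_of_rank_one`). [cite: MazurSteinTate2006, §1]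
[cite: MazurTateTeitelbaum1986Invent, §II.4] -/
theorem canonicalPAdicHeight_ne_zero_of_schneiderConjecture (hr : W.mordellWeilRank = 1)
    {Dh : PAdicHeightData W p} (hDh : Dh.IsCanonical) (hS : SchneiderConjecture Dh)
    {Q : W.toAffine.Point} (hQ : W.IsAdmissible p Q) : W.canonicalPAdicHeight p Q ≠ 0 := by
  intro h0
  exact Dh.not_schneiderConjecture_of_rank_one hr hQ.1 ((hDh Q hQ).trans h0) hS

/-- A curve of Mordell–Weil rank `1` with globally minimal `W` HAS an admissible rational point at
every prime `p` (a Mordell–Weil basis element has infinite order; take an admissible multiple,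
`exists_admissible_nsmul_holds`). [cite: SilvermanAEC2009, VII.6.1] [cite: MazurSteinTate2006, §1] -/
theorem exists_isAdmissible_of_mordellWeilRank_eq_one [W.IsGloballyMinimal]
    (hr : W.mordellWeilRank = 1) : ∃ Q : W.toAffine.Point, W.IsAdmissible p Q := by
  obtain ⟨B, hB⟩ : ∃ B : Fin W.mordellWeilRank → W.toAffine.Point, IsMordellWeilBasis B :=
    W.exists_isMordellWeilBasis_holds
  have hP : ¬ IsOfFinAddOrder (B ⟨0, by omega⟩) := hB.not_isOfFinAddOrder_rat _
  obtain ⟨m, -, hm⟩ := exists_admissible_nsmul_holds W p _ hP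
  exact ⟨_, hm⟩

/-- **Rank one, canonical datum: `Reg_p ≠ 0 ↔` every admissible point has `ĥ_p ≠ 0`** (globally
minimal `W`, any prime `p`; the `←` direction uses the existence of an admissible point).
[cite: MazurSteinTate2006, §1 and Conj. 1.1] -/
theorem schneiderConjecture_iff_forall_isAdmissible [W.IsGloballyMinimal] (hr : W.mordellWeilRank = 1)
    {Dh : PAdicHeightData W p} (hDh : Dh.IsCanonical) :
    SchneiderConjecture Dh ↔ ∀ Q : W.toAffine.Point, W.IsAdmissible p Q → W.canonicalPAdicHeight p Q ≠ 0 := by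
  refine ⟨fun hS Q hQ ↦ canonicalPAdicHeight_ne_zero_of_schneiderConjecture hr hDh hS hQ, fun h ↦ ?_⟩
  obtain ⟨Q, hQ⟩ := exists_isAdmissible_of_mordellWeilRank_eq_one (p := p) hr
  exact schneiderConjecture_of_isAdmissible_of_ne_zero hr hDh hQ (h Q hQ)

/-- **Rank one, canonical datum: `Reg_p ≠ 0 ↔` some admissible point has `ĥ_p ≠ 0`.**
[cite: MazurSteinTate2006, §1 and Conj. 1.1] -/
theorem schneiderConjecture_iff_exists_isAdmissible [W.IsGloballyMinimal] (hr : W.mordellWeilRank = 1)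
    {Dh : PAdicHeightData W p} (hDh : Dh.IsCanonical) :
    SchneiderConjecture Dh ↔ ∃ Q : W.toAffine.Point, W.IsAdmissible p Q ∧ W.canonicalPAdicHeight p Q ≠ 0 := by
  refine ⟨fun hS ↦ ?_, fun ⟨Q, hQ, hne⟩ ↦ schneiderConjecture_of_isAdmissible_of_ne_zero hr hDh hQ hne⟩
  obtain ⟨Q, hQ⟩ := exists_isAdmissible_of_mordellWeilRank_eq_one (p := p) hr
  exact ⟨Q, hQ, canonicalPAdicHeight_ne_zero_of_schneiderConjecture hr hDh hS hQ⟩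

/-- **Schneider's conjecture for a rank-one pair `(E, p)`, `p ≥ 5` good ordinary, WITHOUT the height
datum**: "`Reg_p(E, Dh) ≠ 0` for every canonical `Dh`" iff "`ĥ_p(Q) ≠ 0` for every admissible rational
point `Q`".  (`→`: THE canonical datum exists — tree theorem `exists_isCanonical_holds`; `←`: per-pair
certificate.)  Same content as `Cruxes.PAdicOrderThesisR2.LambdaAdicGZ.schneiderClause_iff_forall_admissible_ne_zero`
(crux 0487's support file `PAdicOrderV2PAdicOrderThesisR2StubRankOneSchneiderTightness`), re-derived here from the
Literature layer so that this file does not build on that route's import cone, and without the idle `p ≥ 5` /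
ordinary hypotheses in the `←` direction. [cite: MazurSteinTate2006, §1 and Conj. 1.1]
[cite: SteinWuthrich2013, §4.1 eq. (4.1)] -/
theorem forall_isCanonical_schneiderConjecture_iff [W.IsGloballyMinimal] (hp : 5 ≤ p)
    (hgood : W.HasGoodReductionAtPrime p) (hord : ¬ (p : ℤ) ∣ W.frobeniusTrace p)
    (hr : W.mordellWeilRank = 1) :
    (∀ Dh : PAdicHeightData W p, Dh.IsCanonical → SchneiderConjecture Dh) ↔
      ∀ Q : W.toAffine.Point, W.IsAdmissible p Q → W.canonicalPAdicHeight p Q ≠ 0 := by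
  constructor
  · intro h Q hQ
    obtain ⟨Dh, hDh⟩ := exists_isCanonical_holds W p hp hgood hord
    exact canonicalPAdicHeight_ne_zero_of_schneiderConjecture hr hDh (h Dh hDh) hQ
  · intro h Dh hDh
    exact (schneiderConjecture_iff_forall_isAdmissible hr hDh).mpr h

omit [W.IsElliptic] in
/-- The canonical height of an affine admissible point, in coordinates (definitional unfolding of
`canonicalPAdicHeight`, Stein–Wuthrich (4.1)): `ĥ_p(x, y) = log_p(den x) - 2 log_p σ_p(-x/y)`.
[cite: SteinWuthrich2013, §4.1 eq. (4.1)] -/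
theorem canonicalPAdicHeight_some_eq {x y : ℚ} (h : W.toAffine.Nonsingular x y) :
    W.canonicalPAdicHeight p (.some x y h) =
      padicLog p ((x.den : ℚ) : ℚ_[p]) - 2 * padicLog p (W.padicSigmaEval p (-(x : ℚ_[p]) / y)) :=
  rfl

omit [W.IsElliptic] in
/-- `ĥ_p ≠ 0` on all admissible points, phrased in coordinates: the point at infinity is never
admissible, and on affine points `ĥ_p(x,y) ≠ 0 ↔ log_p(den x) ≠ 2 log_p σ_p(-x/y)`.
[cite: SteinWuthrich2013, §4.1 eq. (4.1)] -/
theorem forall_isAdmissible_ne_zero_iff_coordinates :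
    (∀ Q : W.toAffine.Point, W.IsAdmissible p Q → W.canonicalPAdicHeight p Q ≠ 0) ↔
      ∀ {x y : ℚ} (h : W.toAffine.Nonsingular x y), W.IsAdmissible p (.some x y h) →
        padicLog p ((x.den : ℚ) : ℚ_[p]) ≠
          2 * padicLog p (W.padicSigmaEval p (-(x : ℚ_[p]) / y)) := by
  constructor
  · intro hall x y h hQ heq
    exact hall _ hQ (by rw [canonicalPAdicHeight_some_eq, heq, sub_self])
  · intro hall Q hQ
    cases Q with
    | zero => exact absurd hQ (W.not_isAdmissible_zero p)
    | @some x y h =>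
      rw [canonicalPAdicHeight_some_eq]
      exact sub_ne_zero.mpr (hall h hQ)

end PerPair

/-! ### Class level: the crux in height-atomic form, modulo Gross–Zagier–Kolyvagin only -/

/-- Gross–Zagier–Kolyvagin (`hGZK`, the tree's named fact
`rank_eq_analyticRank_of_analyticRank_le_one`) reads `analyticRank = 1` as `rank E(ℚ) = 1`.
[cite: Kolyvagin1990, Thm. A] -/
theorem mordellWeilRank_eq_one_of_analyticRank (hGZK : rank_eq_analyticRank_of_analyticRank_le_one)
    (W : WeierstrassCurve ℚ) [W.IsElliptic] (han : W.analyticRank = 1) : W.mordellWeilRank = 1 :=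
  (hGZK W han.le).1.trans han

/-- **The height form is SUFFICIENT for the crux, modulo GZK only.**  If every rank-one X9 pair
`(W, p)` carries SOME admissible rational point with `ĥ_p ≠ 0`, then
`Theses.SmallImageMuTransfer.SchneiderX9RankOne` holds (by name).  No Perrin-Riou, no modularity, no
Iwasawa theory: only `hGZK` (to know `rank E(ℚ) = 1`). [cite: MazurSteinTate2006, §1 and Conj. 1.1] -/
theorem schneiderX9RankOne_of_exists_heightForm (hGZK : rank_eq_analyticRank_of_analyticRank_le_one)
    (h : ∀ (W : WeierstrassCurve ℚ) [W.IsElliptic] [W.IsGloballyMinimal] (p : ℕ) [Fact p.Prime],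
      ClassX9 W p → W.analyticRank = 1 →
        ∃ Q : W.toAffine.Point, W.IsAdmissible p Q ∧ W.canonicalPAdicHeight p Q ≠ 0) :
    Theses.SmallImageMuTransfer.SchneiderX9RankOne := by
  unfold Theses.SmallImageMuTransfer.SchneiderX9RankOne
  intro W _ _ p _ hX9 han Dh hDh
  obtain ⟨Q, hQ, hne⟩ := h W p hX9 han
  exact schneiderConjecture_of_isAdmissible_of_ne_zero (mordellWeilRank_eq_one_of_analyticRank hGZK W han)
    hDh hQ hne

/-- **The height form is NECESSARY for the crux, modulo GZK only**: the crux forces `ĥ_p(Q) ≠ 0` for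
EVERY admissible rational point of every rank-one X9 pair (the canonical datum exists at `p ≥ 5` good
ordinary — inside `ClassX9` —, tree theorem `exists_isCanonical_holds`).
[cite: MazurSteinTate2006, §1 and Conj. 1.1] -/
theorem heightForm_of_schneiderX9RankOne (hGZK : rank_eq_analyticRank_of_analyticRank_le_one)
    (h3 : Theses.SmallImageMuTransfer.SchneiderX9RankOne) :
    ∀ (W : WeierstrassCurve ℚ) [W.IsElliptic] [W.IsGloballyMinimal] (p : ℕ) [Fact p.Prime],
      ClassX9 W p → W.analyticRank = 1 →
        ∀ Q : W.toAffine.Point, W.IsAdmissible p Q → W.canonicalPAdicHeight p Q ≠ 0 := by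
  unfold Theses.SmallImageMuTransfer.SchneiderX9RankOne at h3
  intro W _ _ p _ hX9 han
  exact (forall_isCanonical_schneiderConjecture_iff hX9.2.1 hX9.2.2.1 hX9.2.2.2.1
    (mordellWeilRank_eq_one_of_analyticRank hGZK W han)).mp (h3 W p hX9 han)

/-- **Crux `SchneiderX9RankOne` ⟺ its height-atomic form, modulo Gross–Zagier–Kolyvagin only**:
Schneider's non-degeneracy on the rank-one X9 pairs (every canonical datum) iff every admissible
rational point of every rank-one X9 pair has non-zero canonical `p`-adic height.
[cite: MazurSteinTate2006, §1 and Conj. 1.1] [cite: SteinWuthrich2013, §4.1 eq. (4.1)] -/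
theorem schneiderX9RankOne_iff_heightForm (hGZK : rank_eq_analyticRank_of_analyticRank_le_one) :
    Theses.SmallImageMuTransfer.SchneiderX9RankOne ↔
      ∀ (W : WeierstrassCurve ℚ) [W.IsElliptic] [W.IsGloballyMinimal] (p : ℕ) [Fact p.Prime],
        ClassX9 W p → W.analyticRank = 1 →
          ∀ Q : W.toAffine.Point, W.IsAdmissible p Q → W.canonicalPAdicHeight p Q ≠ 0 := by
  refine ⟨heightForm_of_schneiderX9RankOne hGZK, fun h ↦ schneiderX9RankOne_of_exists_heightForm hGZK ?_⟩
  intro W _ _ p _ hX9 han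
  obtain ⟨Q, hQ⟩ := exists_isAdmissible_of_mordellWeilRank_eq_one (p := p)
    (mordellWeilRank_eq_one_of_analyticRank hGZK W han)
  exact ⟨Q, hQ, h W p hX9 han Q hQ⟩

/-- **Crux `SchneiderX9RankOne` ⟺ the `∃`-form** (one good admissible point per pair), modulo GZK.
[cite: MazurSteinTate2006, §1 and Conj. 1.1] -/
theorem schneiderX9RankOne_iff_exists_heightForm (hGZK : rank_eq_analyticRank_of_analyticRank_le_one) :
    Theses.SmallImageMuTransfer.SchneiderX9RankOne ↔
      ∀ (W : WeierstrassCurve ℚ) [W.IsElliptic] [W.IsGloballyMinimal] (p : ℕ) [Fact p.Prime],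
        ClassX9 W p → W.analyticRank = 1 →
          ∃ Q : W.toAffine.Point, W.IsAdmissible p Q ∧ W.canonicalPAdicHeight p Q ≠ 0 := by
  refine ⟨fun h3 W _ _ p _ hX9 han ↦ ?_, schneiderX9RankOne_of_exists_heightForm hGZK⟩
  obtain ⟨Q, hQ⟩ := exists_isAdmissible_of_mordellWeilRank_eq_one (p := p)
    (mordellWeilRank_eq_one_of_analyticRank hGZK W han)
  exact ⟨Q, hQ, heightForm_of_schneiderX9RankOne hGZK h3 W p hX9 han Q hQ⟩

/-- **THE CRUX IN COORDINATES (modulo Gross–Zagier–Kolyvagin only).**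
`SchneiderX9RankOne ↔` for every X9 pair `(W, p)` (non-CM, `p ≥ 5` good ordinary, `E[p]` irreducible,
`ρ̄_{E,p}` not surjective) with `ord_{s=1} L(E, s) = 1` and every ADMISSIBLE rational point
`(x, y) ∈ E(ℚ)` (infinite order, `ord_p x < 0`, `-x/y` in the sigma disc, non-singular reduction
everywhere): `log_p(den x) ≠ 2 · log_p σ_p(-x/y)` — `log_p` the Iwasawa logarithm, `σ_p` the canonical
`p`-adic sigma function of `W`.  This is the `p`-adic transcendence statement the crux consists of; no
height datum, `L`-function or Iwasawa module occurs in it. [cite: MazurSteinTate2006, §1 and Conj. 1.1]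
[cite: SteinWuthrich2013, §4.1 eq. (4.1)] -/
theorem schneiderX9RankOne_iff_padicLog_den_ne (hGZK : rank_eq_analyticRank_of_analyticRank_le_one) :
    Theses.SmallImageMuTransfer.SchneiderX9RankOne ↔
      ∀ (W : WeierstrassCurve ℚ) [W.IsElliptic] [W.IsGloballyMinimal] (p : ℕ) [Fact p.Prime],
        ClassX9 W p → W.analyticRank = 1 →
          ∀ {x y : ℚ} (h : W.toAffine.Nonsingular x y), W.IsAdmissible p (.some x y h) →
            padicLog p ((x.den : ℚ) : ℚ_[p]) ≠
              2 * padicLog p (W.padicSigmaEval p (-(x : ℚ_[p]) / y)) := by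
  rw [schneiderX9RankOne_iff_heightForm hGZK]
  refine forall_congr' fun W ↦ forall_congr' fun _ ↦ forall_congr' fun _ ↦ forall_congr' fun p ↦
    forall_congr' fun _ ↦ forall_congr' fun _ ↦ forall_congr' fun _ ↦ ?_
  exact forall_isAdmissible_ne_zero_iff_coordinates

/-- **Per-pair closure of the crux AT ONE PAIR, no published input**: for an X9 pair `(W, p)` with
`rank E(ℚ) = 1` (the Mordell–Weil rank, so that GZK is not needed), ONE admissible rational point
`(x, y)` with `log_p(den x) ≠ 2 log_p σ_p(-x/y)` gives `Reg_p(E, Dh) ≠ 0` for every canonical `Dh` — the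
shape of a kernel certificate for a single pair. [cite: MazurSteinTate2006, §1 and Conj. 1.1] -/
theorem schneiderConjecture_of_coordinates {W : WeierstrassCurve ℚ} [W.IsElliptic] {p : ℕ}
    [Fact p.Prime] (hr : W.mordellWeilRank = 1) {x y : ℚ} (h : W.toAffine.Nonsingular x y)
    (hQ : W.IsAdmissible p (.some x y h))
    (hne : padicLog p ((x.den : ℚ) : ℚ_[p]) ≠ 2 * padicLog p (W.padicSigmaEval p (-(x : ℚ_[p]) / y)))
    (Dh : PAdicHeightData W p) (hDh : Dh.IsCanonical) : SchneiderConjecture Dh :=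
  schneiderConjecture_of_isAdmissible_of_ne_zero hr hDh hQ
    (by rw [canonicalPAdicHeight_some_eq]; exact sub_ne_zero.mpr hne)

/-! ### The X9 height form is crux 0515's registered open stub H, restricted to X9 -/

/-- **Crux 0515's height-side open core implies this crux, modulo GZK only.**  The registered line
`Cruxes/PAdicOrderRankOneR4/Lines/height_side_schneider.lean` of crux `PAdicOrderRankOneR4`
(stmt-BirchSwinnertonDyer-0515) has the open stub H `stub_schneiderRankOne` — its signature is the hypothesis
`hH` below VERBATIM: every admissible rational point of every analytic-rank-one curve has `ĥ_p ≠ 0` at every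
good ordinary `p ≥ 5`.  Restricted to X9 pairs (`p ≥ 5` good ordinary is inside `ClassX9`) it is this file's
height form, hence gives `Theses.SmallImageMuTransfer.SchneiderX9RankOne` by name, granted GZK.  (Compare
p606472: the ANALYTIC open stub of line `birth` is crux 0515 itself restricted to X9; here the HEIGHT-side
stub H of 0515's line suffices, with one published input instead of three.)
[cite: MazurSteinTate2006, §1 and Conj. 1.1] -/
theorem schneiderX9RankOne_of_stubH (hGZK : rank_eq_analyticRank_of_analyticRank_le_one)
    (hH : ∀ (W : WeierstrassCurve ℚ) [W.IsElliptic] [W.IsGloballyMinimal] (p : ℕ) [Fact p.Prime],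
      5 ≤ p → IsOrdinaryAt W p → W.analyticRank = 1 →
        ∀ P : W.toAffine.Point, W.IsAdmissible p P → W.canonicalPAdicHeight p P ≠ 0) :
    Theses.SmallImageMuTransfer.SchneiderX9RankOne :=
  (schneiderX9RankOne_iff_heightForm hGZK).mpr fun W _ _ p _ hX9 han ↦
    hH W p hX9.2.1 ⟨hX9.2.2.1, hX9.2.2.2.1⟩ han

/-! ### Bookkeeping for line `birth`: height form ⟹ `stub_orderOne`; tightness without `hcan` -/

/-- **Height form ⟹ the open stub `stub_orderOne` of line `birth`**, modulo Perrin-Riou 1987 Cor. 1.8 (`hPR`)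
and GZK (`hGZK`): on a rank-one X9 pair, ONE admissible point with `ĥ_p ≠ 0` gives `Reg_p(E, Dh) ≠ 0` for THE
canonical datum (which exists, `exists_isCanonical_holds`), and Perrin-Riou's identity
`[T¹]L_p · log_p γ = q (1 − α⁻¹)² Reg_p` (`Wuthrich2014.coeff_one_padicLFunction_ne_zero_iff_schneider`) turns
that into `[T¹] L_p(f, α, T) ≠ 0` for every newform `f`.  Conclusion = registered signature of `stub_orderOne`
verbatim.  So the two faces of the crux — analytic (`stub_orderOne` = crux 0515 on X9) and height-atomic (this
file) — agree modulo the published inputs. [cite: PerrinRiou1987, §1.4 Cor. 1.8] -/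
theorem orderOne_of_exists_heightForm (hPR : perrinRiou_rankOne_leadingTerms)
    (hGZK : rank_eq_analyticRank_of_analyticRank_le_one)
    (h : ∀ (W : WeierstrassCurve ℚ) [W.IsElliptic] [W.IsGloballyMinimal] (p : ℕ) [Fact p.Prime],
      ClassX9 W p → W.analyticRank = 1 →
        ∃ Q : W.toAffine.Point, W.IsAdmissible p Q ∧ W.canonicalPAdicHeight p Q ≠ 0) :
    ∀ (W : WeierstrassCurve ℚ) [W.IsElliptic] [W.IsGloballyMinimal] (p : ℕ) [Fact p.Prime]
      {N : ℕ} [NeZero N] (f : CuspForm (Gamma0 N) 2),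
      ClassX9 W p → W.analyticRank = 1 → IsNewformOf W f →
        PowerSeries.coeff 1 (padicLFunction f (unitRoot W p : ℚ_[p])) ≠ 0 := by
  intro W _ _ p _ N _ f hX9 han hf
  obtain ⟨Dh, hDh⟩ := exists_isCanonical_holds W p hX9.2.1 hX9.2.2.1 hX9.2.2.2.1
  obtain ⟨Q, hQ, hne⟩ := h W p hX9 han
  exact (coeff_one_padicLFunction_ne_zero_iff_schneider hPR hGZK W p hX9.2.1 ⟨hX9.2.2.1, hX9.2.2.2.1⟩ han Dh hDh
    f hf).mpr (schneiderConjecture_of_isAdmissible_of_ne_zero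
      (mordellWeilRank_eq_one_of_analyticRank hGZK W han) hDh hQ hne)

/-- **Tightness of line `birth` without the existence hypothesis**: modulo Perrin-Riou 1987 Cor. 1.8 and GZK
alone, the crux implies its open stub `stub_orderOne` (p606472's `orderOne_of_schneiderX9RankOne` took
`hcan : exists_isCanonical` as a hypothesis; it is the tree theorem `exists_isCanonical_holds`).  Re-derived from
the Literature layer (this file stays off p606472's import cone). [cite: PerrinRiou1987, §1.4 Cor. 1.8] -/
theorem orderOne_of_schneiderX9RankOne_uncond (hPR : perrinRiou_rankOne_leadingTerms)
    (hGZK : rank_eq_analyticRank_of_analyticRank_le_one)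
    (h3 : Theses.SmallImageMuTransfer.SchneiderX9RankOne) :
    ∀ (W : WeierstrassCurve ℚ) [W.IsElliptic] [W.IsGloballyMinimal] (p : ℕ) [Fact p.Prime]
      {N : ℕ} [NeZero N] (f : CuspForm (Gamma0 N) 2),
      ClassX9 W p → W.analyticRank = 1 → IsNewformOf W f →
        PowerSeries.coeff 1 (padicLFunction f (unitRoot W p : ℚ_[p])) ≠ 0 :=
  orderOne_of_exists_heightForm hPR hGZK ((schneiderX9RankOne_iff_exists_heightForm hGZK).mp h3)

/-- **Crux ⟺ `stub_orderOne` modulo Perrin-Riou 1987 Cor. 1.8, GZK and modularity** (no `hcan`): the line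
`birth` is tight given exactly its own published stub. (`←` is p415447's `schneiderX9RankOne_of_perrinRiou`.)
[cite: PerrinRiou1987, §1.4 Cor. 1.8] -/
theorem schneiderX9RankOne_iff_orderOne_uncond (hPR : perrinRiou_rankOne_leadingTerms)
    (hGZK : rank_eq_analyticRank_of_analyticRank_le_one) (hmodP : nonempty_modularParametrizationData) :
    Theses.SmallImageMuTransfer.SchneiderX9RankOne ↔
      ∀ (W : WeierstrassCurve ℚ) [W.IsElliptic] [W.IsGloballyMinimal] (p : ℕ) [Fact p.Prime]
        {N : ℕ} [NeZero N] (f : CuspForm (Gamma0 N) 2),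
        ClassX9 W p → W.analyticRank = 1 → IsNewformOf W f →
          PowerSeries.coeff 1 (padicLFunction f (unitRoot W p : ℚ_[p])) ≠ 0 := by
  refine ⟨orderOne_of_schneiderX9RankOne_uncond hPR hGZK, fun h1 ↦ ?_⟩
  unfold Theses.SmallImageMuTransfer.SchneiderX9RankOne
  exact schneiderX9RankOne_of_perrinRiou hPR hGZK hmodP h1

end Summit.BirchSwinnertonDyer.BirchSwinnertonDyer.Rank1Residual

end
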